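import Summits.QuantumFields.YangMills.Theorems.AllWindowsColdBoxBoxHighLineK3PrimeRowW4Record
import Summits.QuantumFields.YangMills.Theorems.AllWindowsColdBoxBoxHighLinePhiQuarticLocalForm

/-!
# U5 K3′ — the even polynomial VERTEX OF RECORD `Vr := −W4 − β·phiQuartic` for the hK3 row-sum: ONE existential with all five side facts
# (planner ym-idea-2 g19 «(a)» 2026-08-30T02:19:30Z; row-sum ✓`tiltCum3_cutSet_size_of_rows (Vr) (mVr) (bVr) (hE1r) (hRA) …` of fcl-p3 g27; LINE-20 U5 ⟨stmt-QuantumFields-24336⟩ —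
# U5 prep, helper-grade)

Extra width seat `ym-line-sfw-p2-w4` (g30).  ✓`K3RowSum.hW4_of_record` packages the quartic Wilson tensor `Q` of record with the measurability of
`W4 β H a := β·Σ_p Σ_{ijkl} Q…(plaqVar_p a)` and its sextic sup remainder.  The row-sum is instantiated at `Vr β H a := −W4 β H a − β·phiQuartic H a` and also wants
`mVr : ∀ β H, Measurable (Vr β H)` and `bVr : ∀ β H s, ∃ BV, ∀ a ∈ smallField H s, |Vr β H a| ≤ BV`.  Since `hE1r`, `hRA`, `mVr`, `bVr` must all refer to THE SAME `Q`,
everything is bundled in one existential: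

* ★ `K3RowSum.vertex_of_record` — `∃ Q, (|Q| ≤ 1/2) ∧ (∀ β H, Measurable (W4 β H)) ∧ (sextic remainder `81920·β·H⁴·s⁶`) ∧ (∀ β H, Measurable (Vr β H)) ∧
  (∀ β H s, ∃ BV, ∀ a ∈ smallField H s, |Vr β H a| ≤ BV)` with `W4`, `Vr` spelled out as explicit lambdas (sup of `W4` by w3 g42's ✓`WilsonTaylor.abs_quarticPairSum_le`
  and ✓`EdgeChartGaussian.card_plaquettesTouching_le`; sup of `phiQuartic` by w2 g33's ✓`PhiQuartic.abs_phiQuartic_le_of_mem_smallField`; both at `max s 0`, so no sign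
  hypothesis on `s` is needed).

No definitions; tree only; standard axioms.  HONEST LABEL: helper-grade packaging for the UNSTAFFED stub U5; `hK3`, U5, ⟨24336⟩, ⟨24004⟩ and this seat's crux
⟨stmt-QuantumFields-22884⟩ remain OPEN; route AllWindowsColdBox is DRAFT; no crux, rung or summit is proved; **the Yang–Mills mass gap is NOT proved by this file; no
summit is proved by a line.**
-/

set_option autoImplicit false

noncomputable section

open MeasureTheory Matrix Finset
open Literature.Probability.LatticeModels (Site)
open Literature.MathematicalPhysics.QuantumLattice (ZdPlaquette plaquettesTouching)
open Literature.MathematicalPhysics.QuantumFieldTheory.AxialGauge (boxEdges)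

namespace Summit.QuantumFields.YangMills.Theorems.AllWindowsColdBoxBoxHighLine

namespace K3RowSum

/-- ★ **The even polynomial vertex of record**, one existential: the quartic tensor `Q` (`|Q| ≤ 1/2`), measurability and sextic remainder of
`W4 = β·Σ_p Σ Q(v·v)(v·v)`, and measurability + a sup bound on every `smallField H s` of `Vr = −W4 − β·phiQuartic`. -/
theorem vertex_of_record : ∃ Q : Fin 4 → Fin 4 → Fin 4 → Fin 4 → ℝ, (∀ i j k l, |Q i j k l| ≤ 1 / 2) ∧
    (∀ (β : ℝ) (H : ℕ), Measurable fun a : LandauFree H → E3 =>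
      β * ∑ p ∈ plaquettesTouching (boxEdges 4 (2 * H + 1)), ∑ i : Fin 4, ∑ j : Fin 4, ∑ k : Fin 4, ∑ l : Fin 4, Q i j k l *
        ((WithLp.ofLp (plaqVar H p.1 p.2.1.1 p.2.1.2 a i) ⬝ᵥ WithLp.ofLp (plaqVar H p.1 p.2.1.1 p.2.1.2 a j)) *
          (WithLp.ofLp (plaqVar H p.1 p.2.1.1 p.2.1.2 a k) ⬝ᵥ WithLp.ofLp (plaqVar H p.1 p.2.1.1 p.2.1.2 a l)))) ∧
    (∀ H : ℕ, 1 ≤ H → ∀ β : ℝ, 0 < β → ∀ s : ℝ, 0 ≤ s → s ≤ 1 → ∀ a ∈ smallField H s,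
      |quarticWilson β H a - β * ∑ p ∈ plaquettesTouching (boxEdges 4 (2 * H + 1)), ∑ i : Fin 4, ∑ j : Fin 4, ∑ k : Fin 4, ∑ l : Fin 4, Q i j k l *
        ((WithLp.ofLp (plaqVar H p.1 p.2.1.1 p.2.1.2 a i) ⬝ᵥ WithLp.ofLp (plaqVar H p.1 p.2.1.1 p.2.1.2 a j)) *
          (WithLp.ofLp (plaqVar H p.1 p.2.1.1 p.2.1.2 a k) ⬝ᵥ WithLp.ofLp (plaqVar H p.1 p.2.1.1 p.2.1.2 a l)))| ≤
        81920 * β * (H : ℝ) ^ 4 * s ^ 6) ∧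
    (∀ (β : ℝ) (H : ℕ), Measurable fun a : LandauFree H → E3 =>
      -(β * ∑ p ∈ plaquettesTouching (boxEdges 4 (2 * H + 1)), ∑ i : Fin 4, ∑ j : Fin 4, ∑ k : Fin 4, ∑ l : Fin 4, Q i j k l *
        ((WithLp.ofLp (plaqVar H p.1 p.2.1.1 p.2.1.2 a i) ⬝ᵥ WithLp.ofLp (plaqVar H p.1 p.2.1.1 p.2.1.2 a j)) *
          (WithLp.ofLp (plaqVar H p.1 p.2.1.1 p.2.1.2 a k) ⬝ᵥ WithLp.ofLp (plaqVar H p.1 p.2.1.1 p.2.1.2 a l)))) - β * phiQuartic H a) ∧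
    (∀ (β : ℝ) (H : ℕ) (s : ℝ), ∃ BV : ℝ, ∀ a ∈ smallField H s,
      |-(β * ∑ p ∈ plaquettesTouching (boxEdges 4 (2 * H + 1)), ∑ i : Fin 4, ∑ j : Fin 4, ∑ k : Fin 4, ∑ l : Fin 4, Q i j k l *
        ((WithLp.ofLp (plaqVar H p.1 p.2.1.1 p.2.1.2 a i) ⬝ᵥ WithLp.ofLp (plaqVar H p.1 p.2.1.1 p.2.1.2 a j)) *
          (WithLp.ofLp (plaqVar H p.1 p.2.1.1 p.2.1.2 a k) ⬝ᵥ WithLp.ofLp (plaqVar H p.1 p.2.1.1 p.2.1.2 a l)))) - β * phiQuartic H a| ≤ BV) := by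
  obtain ⟨Q, hQ, mW4, hW4⟩ := hW4_of_record
  refine ⟨Q, hQ, mW4, hW4, fun β H => (mW4 β H).neg.sub ((PhiQuartic.measurable_phiQuartic H).const_mul β), fun β H s => ?_⟩
  set PT := plaquettesTouching (boxEdges 4 (2 * H + 1)) with hPT
  set s' : ℝ := max s 0 with hs'
  have hs'0 : 0 ≤ s' := le_max_right _ _
  refine ⟨|β| * ((PT.card : ℝ) * (16 * (1 / 2) * (4 * s' ^ 2) ^ 2)) + |β| * (1024 * (H : ℝ) ^ 4 * s' ^ 4), fun a ha => ?_⟩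
  have ha' : a ∈ smallField H s' := fun e => (ha e).trans (le_max_left _ _)
  -- the quartic pair sum on the small field
  have hterm : ∀ p ∈ PT, |∑ i : Fin 4, ∑ j : Fin 4, ∑ k : Fin 4, ∑ l : Fin 4, Q i j k l *
      ((WithLp.ofLp (plaqVar H p.1 p.2.1.1 p.2.1.2 a i) ⬝ᵥ WithLp.ofLp (plaqVar H p.1 p.2.1.1 p.2.1.2 a j)) *
        (WithLp.ofLp (plaqVar H p.1 p.2.1.1 p.2.1.2 a k) ⬝ᵥ WithLp.ofLp (plaqVar H p.1 p.2.1.1 p.2.1.2 a l)))| ≤ 16 * (1 / 2) * (4 * s' ^ 2) ^ 2 := by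
    intro p _
    refine (WilsonTaylor.abs_quarticPairSum_le Q hQ _).trans ?_
    have hsq := TiltSup.sum_norm_plaqVar_sq_le hs'0 ha' p.1 p.2.1.1 p.2.1.2
    have h0 : 0 ≤ ∑ i, ‖plaqVar H p.1 p.2.1.1 p.2.1.2 a i‖ ^ 2 := Finset.sum_nonneg fun i _ => sq_nonneg _
    exact mul_le_mul_of_nonneg_left (pow_le_pow_left₀ h0 hsq 2) (by norm_num)
  have hsum : |∑ p ∈ PT, ∑ i : Fin 4, ∑ j : Fin 4, ∑ k : Fin 4, ∑ l : Fin 4, Q i j k l *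
      ((WithLp.ofLp (plaqVar H p.1 p.2.1.1 p.2.1.2 a i) ⬝ᵥ WithLp.ofLp (plaqVar H p.1 p.2.1.1 p.2.1.2 a j)) *
        (WithLp.ofLp (plaqVar H p.1 p.2.1.1 p.2.1.2 a k) ⬝ᵥ WithLp.ofLp (plaqVar H p.1 p.2.1.1 p.2.1.2 a l)))| ≤ (PT.card : ℝ) * (16 * (1 / 2) * (4 * s' ^ 2) ^ 2) := by
    refine (Finset.abs_sum_le_sum_abs _ _).trans ((Finset.sum_le_sum hterm).trans (le_of_eq ?_))
    rw [Finset.sum_const, nsmul_eq_mul]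
  have hW : |-(β * ∑ p ∈ PT, ∑ i : Fin 4, ∑ j : Fin 4, ∑ k : Fin 4, ∑ l : Fin 4, Q i j k l *
      ((WithLp.ofLp (plaqVar H p.1 p.2.1.1 p.2.1.2 a i) ⬝ᵥ WithLp.ofLp (plaqVar H p.1 p.2.1.1 p.2.1.2 a j)) *
        (WithLp.ofLp (plaqVar H p.1 p.2.1.1 p.2.1.2 a k) ⬝ᵥ WithLp.ofLp (plaqVar H p.1 p.2.1.1 p.2.1.2 a l))))| ≤
      |β| * ((PT.card : ℝ) * (16 * (1 / 2) * (4 * s' ^ 2) ^ 2)) := by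
    rw [abs_neg, abs_mul]; exact mul_le_mul_of_nonneg_left hsum (abs_nonneg _)
  have hΦ : |β * phiQuartic H a| ≤ |β| * (1024 * (H : ℝ) ^ 4 * s' ^ 4) := by
    rw [abs_mul]; exact mul_le_mul_of_nonneg_left (PhiQuartic.abs_phiQuartic_le_of_mem_smallField H ha') (abs_nonneg _)
  exact (abs_sub _ _).trans (add_le_add hW hΦ)

end K3RowSum

end Summit.QuantumFields.YangMills.Theorems.AllWindowsColdBoxBoxHighLine
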